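import Summits.MatrixMultiplication.OmegaCensus.AffineExtensionBox

/-!
# ω-census, family (b3): the ONE-ROTATION box of `A ⋊_φ ℤ/n` and its uniform arc pattern (density `11/6`)

HONEST FRAMING (pub-omega census; verbatim): lottery ticket; floor = certified bounds/negative ranges.
Census BOOKKEEPING (conjecture C9 of the cell, STRUCTURE.md §2; pub-omega kernel-l4 gen 18, task K-8).  The box
`Y = {1, y, τ_α}`, `W = {1, τ_β, τ_γ}` of `AffExt A n φ` (`y = (0,1)`, `τ_v = (v,0)`; gauge `sh (i,j) = wv j + yv i`):
* `AffExt.boxF1 α β γ`, its ORDERED label table `AffExt.labF1 κ₁ κ₂ θ c c'` and `AffExt.lam_DD_boxF1`: through every additive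
  `λ : A →+ P` the forbidden differences are the table at the THREE parameters `κ₁ = λ(β − φβ)`, `κ₂ = λ(γ − φγ)`, `θ = λ(φα − α)`
  (for `A = ℤ/p`, `φ = u·`: `(1−u)β`, `(1−u)γ`, `(u−1)α` — free, whatever `u` is: this is why no arithmetic of `u` mod `p` enters);
* `AffExt.ValidF1` (decidable) and `valid_boxF1_of_validF1`; `labF1_intCast`;
* THE UNIFORM ARC TEMPLATE `AffExt.tmplF1 m` in `ZMod m`: with `L = ⌈m/6⌉`, `H = ⌊m/2⌋`, `k = L − ⌊(6L − m)/2⌋` and cut points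
  `(L, L+k, H, H+k, H+L+k)`: `U_j = arcs 0,1,2`, `V_j = arcs 3,4,5`, `M₀ = arc 5`, `M₁ = arc 4`, `M₂ = arcs 1–3`, parameters
  `(κ₁, κ₂, θ) = (k, L+k, m − H)`; valid for every `m ≥ 9` (`tmplF1_valid`: 81 column pairs, each linear arithmetic on
  representatives), with `2m − L` cells (`tmplF1_sum`) — the optimum `⌊11m/6⌋` of this box — so `9m ≤ 5·Σ` iff `5L ≤ m`;
* **`AffExt.not_boxUseful_of_oneRotation`**: `λ : A →+ ZMod p` surjective with `λ ∘ (1 − φ)` surjective, `(1 : ZMod n) ≠ 0`,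
  `9 ≤ p`, `5⌈p/6⌉ ≤ p` ⇒ `A ⋊_φ ℤ/n` is not box-useful.
Used by `MetaCycOneRotation.lean` for the Frobenius groups `C_p ⋊ C_q`, `q ∣ p − 1`.  Nothing here is progress on `ω`.
-/

namespace Summit.MatrixMultiplication.OmegaCensus

open Finset ProductBoxBound

namespace AffExt

variable {A : Type*} [AddCommGroup A] {n : ℕ} (φ : AddMonoid.End A)
variable {P : Type*} [AddCommGroup P]

/-- The one-rotation box `Y = {1, y, τ_α}`, `W = {1, τ_β, τ_γ}` with the gauge `sh (i,j) = wv j + yv i`. [folklore] -/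
def boxF1 (α β γ : A) : ABox A n :=
  ⟨![0, 0, α], ![0, 1, 0], ![0, β, γ], ![0, 0, 0], fun c => ![(0 : A), β, γ] c.2 + ![(0 : A), 0, α] c.1⟩

/-- The ordered label table of the one-rotation box in the parameters `κ₁, κ₂, θ`. [folklore] -/
def labF1 (κ₁ κ₂ θ : P) (c c' : Fin 3 × Fin 3) : P :=
  (![![![![0, 0, 0], ![0, κ₁, κ₂], ![0, 0, 0]],
        ![![0, 0, 0], ![0, κ₁, κ₂], ![0, 0, 0]],
        ![![0, 0, 0], ![0, κ₁, κ₂], ![0, 0, 0]]],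
      ![![![0, -κ₁, -κ₂], ![0, 0, 0], ![θ, -κ₁ + θ, -κ₂ + θ]],
        ![![0, -κ₁, -κ₂], ![0, 0, 0], ![θ, -κ₁ + θ, -κ₂ + θ]],
        ![![0, -κ₁, -κ₂], ![0, 0, 0], ![θ, -κ₁ + θ, -κ₂ + θ]]],
      ![![![0, 0, 0], ![-θ, κ₁ - θ, κ₂ - θ], ![0, 0, 0]],
        ![![0, 0, 0], ![-θ, κ₁ - θ, κ₂ - θ], ![0, 0, 0]],
        ![![0, 0, 0], ![-θ, κ₁ - θ, κ₂ - θ], ![0, 0, 0]]]] :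
    Fin 3 → Fin 3 → Fin 3 → Fin 3 → P) c.1 c.2 c'.1 c'.2

/-- **The forbidden differences of the one-rotation box through any additive `λ`** are the table `labF1` at
`κ₁ = λ(β − φβ)`, `κ₂ = λ(γ − φγ)`, `θ = λ(φα − α)` (`φ` entering as `act φ 1`). [folklore] -/
theorem lam_DD_boxF1 [NeZero n] [Fact (φ ^ n = 1)] (lam : A →+ P) (α β γ : A) (c c' : Fin 3 × Fin 3) :
    lam ((boxF1 (n := n) α β γ).DD φ c c') =
      labF1 (lam β - lam (act φ (1 : ZMod n) β)) (lam γ - lam (act φ (1 : ZMod n) γ))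
        (lam (act φ (1 : ZMod n) α) - lam α) c c' := by
  have hφ : φ ^ n = 1 := Fact.out
  obtain ⟨i, j⟩ := c
  obtain ⟨i', j'⟩ := c'
  fin_cases i <;> fin_cases j <;> fin_cases i' <;> fin_cases j' <;>
    simp [ABox.DD, ABox.sig, boxF1, labF1, act_zero_apply, map_add, map_sub] <;> abel

/-- Additive maps push through the label table. [folklore] -/
theorem labF1_map {P' : Type*} [AddCommGroup P'] (g : P →+ P') (κ₁ κ₂ θ : P) (c c' : Fin 3 × Fin 3) :
    g (labF1 κ₁ κ₂ θ c c') = labF1 (g κ₁) (g κ₂) (g θ) c c' := by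
  obtain ⟨i, j⟩ := c
  obtain ⟨i', j'⟩ := c'
  fin_cases i <;> fin_cases j <;> fin_cases i' <;> fin_cases j' <;> simp [labF1]

/-- Integer parameters: the table in `ZMod m` is the cast of the table in `ℤ`. [folklore] -/
theorem labF1_intCast (m : ℕ) (k₁ k₂ t : ℤ) (c c' : Fin 3 × Fin 3) :
    labF1 (k₁ : ZMod m) (k₂ : ZMod m) (t : ZMod m) c c' = ((labF1 k₁ k₂ t c c' : ℤ) : ZMod m) := by
  have h := labF1_map (Int.castAddHom (ZMod m)) k₁ k₂ t c c'
  simpa using h.symm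

/-- *Validity* of column sets `S c ⊆ P` for the one-rotation table with parameters `κ₁, κ₂, θ`. [folklore] -/
def ValidF1 (κ₁ κ₂ θ : P) (S : Fin 3 × Fin 3 → Finset P) : Prop :=
  ∀ c c' : Fin 3 × Fin 3, c ≠ c' → ∀ z ∈ S c, ∀ z' ∈ S c', z ≠ z' + labF1 κ₁ κ₂ θ c c'

/-- Validity is decidable. [folklore] -/
instance [DecidableEq P] (κ₁ κ₂ θ : P) (S : Fin 3 × Fin 3 → Finset P) : Decidable (ValidF1 κ₁ κ₂ θ S) := by
  unfold ValidF1; infer_instance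

/-- Table validity gives box validity. [folklore] -/
theorem valid_boxF1_of_validF1 [NeZero n] [Fact (φ ^ n = 1)] [DecidableEq P] (lam : A →+ P) (α β γ : A)
    (S : Fin 3 × Fin 3 → Finset P)
    (h : ValidF1 (lam β - lam (act φ (1 : ZMod n) β)) (lam γ - lam (act φ (1 : ZMod n) γ))
      (lam (act φ (1 : ZMod n) α) - lam α) S) :
    (boxF1 (n := n) α β γ).Valid φ lam S := by
  intro c c' hcc' z hz z' hz'
  rw [lam_DD_boxF1]
  exact h c c' hcc' z hz z' hz'

/-- The one-rotation box is nondegenerate when `α, β, γ ≠ 0`, `β ≠ γ` and `(1 : ZMod n) ≠ 0`. [folklore] -/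
theorem boxF1_nondeg {α β γ : A} (hα : α ≠ 0) (hβ : β ≠ 0) (hγ : γ ≠ 0) (hβγ : β ≠ γ) (h1 : (1 : ZMod n) ≠ 0) :
    (boxF1 (n := n) α β γ).Nondeg φ := by
  refine ABox.nondeg_of φ _ ?_ ?_ <;> intro i i' e <;> fin_cases i <;> fin_cases i' <;>
    simp_all [boxF1, eq_comm]

/-! ### Arcs of `ZMod m` and representatives -/

section Template

variable (m : ℕ) [NeZero m]

/-- The arc `[lo, hi)` of `ZMod m` (by the canonical representative). [folklore] -/
def arc (lo hi : ℕ) : Finset (ZMod m) := univ.filter fun z => lo ≤ z.val ∧ z.val < hi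

/-- Membership in an arc. [folklore] -/
@[simp] theorem mem_arc {lo hi : ℕ} {z : ZMod m} : z ∈ arc m lo hi ↔ lo ≤ z.val ∧ z.val < hi := by simp [arc]

/-- An arc `[lo, hi)` with `hi ≤ m` has `hi − lo` elements. [folklore] -/
theorem card_arc {lo hi : ℕ} (hhi : hi ≤ m) : #(arc m lo hi) = hi - lo := by
  have : arc m lo hi = (Ico lo hi).image (fun k : ℕ => (k : ZMod m)) := by
    ext z
    simp only [mem_arc, mem_image, mem_Ico]
    constructor
    · intro hz; exact ⟨z.val, hz, ZMod.natCast_zmod_val z⟩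
    · rintro ⟨k, hk, rfl⟩
      rw [ZMod.val_natCast, Nat.mod_eq_of_lt (by omega)]; exact hk
  rw [this, card_image_of_injOn, Nat.card_Ico]
  intro k hk k' hk' e
  have := congrArg ZMod.val e
  simp only [mem_coe, mem_Ico] at hk hk'
  rwa [ZMod.val_natCast, ZMod.val_natCast, Nat.mod_eq_of_lt (by omega), Nat.mod_eq_of_lt (by omega)] at this

/-- Representatives of `z = z' + d` for an integer `d` with `|d| < m`: `z.val − z'.val − d ∈ {0, m, −m}`. [folklore] -/
theorem val_eq_cases {z z' : ZMod m} {d : ℤ} (e : z = z' + (d : ZMod m)) (hd : -(m : ℤ) < d ∧ d < m) :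
    (z.val : ℤ) = z'.val + d ∨ (z.val : ℤ) = z'.val + d + m ∨ (z.val : ℤ) = z'.val + d - m := by
  have hz : ((z.val : ℤ) : ZMod m) = (((z'.val : ℤ) + d : ℤ) : ZMod m) := by
    push_cast
    rw [ZMod.natCast_zmod_val, ZMod.natCast_zmod_val, e]
  rw [ZMod.intCast_eq_intCast_iff_dvd_sub] at hz
  obtain ⟨t, ht⟩ := hz
  have h1 := ZMod.val_lt z
  have h2 := ZMod.val_lt z'
  have hm : (0 : ℤ) < m := by have := NeZero.pos m; omega
  have ht1 : t < 2 := by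
    by_contra hc
    push Not at hc
    have : (m : ℤ) * 2 ≤ (m : ℤ) * t := mul_le_mul_of_nonneg_left hc hm.le
    omega
  have ht2 : -2 < t := by
    by_contra hc
    push Not at hc
    have : (m : ℤ) * t ≤ (m : ℤ) * (-2) := mul_le_mul_of_nonneg_left hc hm.le
    omega
  have ht3 : t = -1 ∨ t = 0 ∨ t = 1 := by omega
  rcases ht3 with rfl | rfl | rfl <;> omega

/-! ### The uniform arc template -/

/-- `L = ⌈m/6⌉`. [folklore] -/
def tL : ℕ := (m + 5) / 6
/-- `H = ⌊m/2⌋`. [folklore] -/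
def tH : ℕ := m / 2
/-- `k = L − ⌊(6L − m)/2⌋` (the first parameter `κ₁`). [folklore] -/
def tk : ℕ := tL m - (6 * tL m - m) / 2

/-- The uniform one-rotation template (arcs with cut points `(L, L+k, H, H+k, H+L+k)`): `U_j = arcs 0,1,2` (row `0`),
`M₀, M₁, M₂ = arc 5, arc 4, arcs 1–3` (row `1`), `V_j = arcs 3,4,5` (row `2`). [folklore] -/
def tmplF1 (c : Fin 3 × Fin 3) : Finset (ZMod m) :=
  (![![arc m 0 (tL m), arc m (tL m) (tL m + tk m), arc m (tL m + tk m) (tH m)],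
      ![arc m (tH m + tL m + tk m) m, arc m (tH m + tk m) (tH m + tL m + tk m), arc m (tL m) (tH m + tk m)],
      ![arc m (tH m) (tH m + tk m), arc m (tH m + tk m) (tH m + tL m + tk m), arc m (tH m + tL m + tk m) m]] :
    Fin 3 → Fin 3 → Finset (ZMod m)) c.1 c.2

omit [NeZero m] in
/-- The defining inequalities of `L = ⌈m/6⌉`, `H = ⌊m/2⌋`, `k = L − ⌊(6L−m)/2⌋` (all that the validity proof uses). [folklore] -/
theorem tmpl_ineq (hm : 9 ≤ m) :
    m ≤ 6 * tL m ∧ 6 * tL m ≤ m + 5 ∧ 2 * tH m ≤ m ∧ m ≤ 2 * tH m + 1 ∧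
      2 * (tL m - tk m) ≤ 6 * tL m - m ∧ 6 * tL m - m ≤ 2 * (tL m - tk m) + 1 ∧ 1 ≤ tk m ∧ tk m ≤ tL m := by
  simp only [tk, tL, tH]
  omega

set_option maxHeartbeats 1600000 in
/-- **The uniform arc template is valid** for the parameters `(k, L + k, m − H)` in every `ZMod m`, `m ≥ 9`. [folklore] -/
theorem tmplF1_valid (hm : 9 ≤ m) :
    ValidF1 ((tk m : ℤ) : ZMod m) (((tL m + tk m : ℕ) : ℤ) : ZMod m) (((m - tH m : ℕ) : ℤ) : ZMod m) (tmplF1 m) := by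
  have hI := tmpl_ineq m hm
  intro c c' hcc' z hz z' hz' e
  rw [labF1_intCast] at e
  generalize hd : labF1 (tk m : ℤ) ((tL m + tk m : ℕ) : ℤ) ((m - tH m : ℕ) : ℤ) c c' = d at e
  have hzv := ZMod.val_lt z
  have hzv' := ZMod.val_lt z'
  obtain ⟨i, j⟩ := c
  obtain ⟨i', j'⟩ := c'
  fin_cases i <;> fin_cases j <;> fin_cases i' <;> fin_cases j' <;>
    first
      | exact (hcc' rfl).elim
      | (simp [tmplF1, labF1] at hz hz' hd
         rcases val_eq_cases m e (by omega) with h | h | h <;> omega)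

/-- The column sums of the uniform template: `Σ_c #(tmplF1 m c) = 2m − L`. [folklore] -/
theorem tmplF1_sum (hm : 9 ≤ m) : ∑ c, #(tmplF1 m c) = 2 * m - tL m := by
  have hI := tmpl_ineq m hm
  rw [Fintype.sum_prod_type]
  simp [Fin.sum_univ_three, tmplF1]
  repeat rw [card_arc m (by omega)]
  omega

/-- `9m ≤ 5·Σ_c #(tmplF1 m c)` as soon as `5L ≤ m` (`m ≥ 9`). [folklore] -/
theorem tmplF1_big (hm : 9 ≤ m) (hL : 5 * ((m + 5) / 6) ≤ m) : 9 * m ≤ 5 * ∑ c, #(tmplF1 m c) := by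
  rw [tmplF1_sum m hm, tL]
  omega

end Template

/-! ### The theorem -/

/-- **The one-rotation theorem.** Let `p ≥ 9` with `5⌈p/6⌉ ≤ p` be prime, `λ : A →+ ZMod p` surjective with `λ ∘ (1 − φ)`
surjective, `(1 : ZMod n) ≠ 0`.  Then `A ⋊_φ ℤ/n` is not box-useful: the coset pattern of the arc template on the box
`{1, y, τ_α} × {1, τ_β, τ_γ}` for suitable `α, β, γ` has `≥ (9/5)·|A|·n` independent cells. [folklore] -/
theorem not_boxUseful_of_oneRotation [Fintype A] [DecidableEq A] [NeZero n] [Fact (φ ^ n = 1)] {p : ℕ} [Fact p.Prime]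
    (lam : A →+ ZMod p) (hlam : Function.Surjective lam)
    (hsub : ∀ x : ZMod p, ∃ v : A, lam v - lam (act φ (1 : ZMod n) v) = x) (h1 : (1 : ZMod n) ≠ 0) (hp9 : 9 ≤ p)
    (hL : 5 * ((p + 5) / 6) ≤ p) : ¬ BoxUseful (AffExt A n φ) := by
  have hp : p.Prime := Fact.out
  haveI : NeZero p := ⟨hp.ne_zero⟩
  have hI := tmpl_ineq p hp9
  -- realise the three parameters
  have realise : ∀ k : ℕ, 1 ≤ k → k < p → ∃ v : A, v ≠ 0 ∧ lam v - lam (act φ (1 : ZMod n) v) = (k : ZMod p) := by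
    intro k hk1 hkp
    obtain ⟨v, hv⟩ := hsub (k : ZMod p)
    refine ⟨v, ?_, hv⟩
    rintro rfl
    simp only [map_zero, sub_zero] at hv
    have := (ZMod.natCast_eq_zero_iff k p).1 hv.symm
    exact absurd (Nat.le_of_dvd (by omega) this) (by omega)
  obtain ⟨β, hβ, hb⟩ := realise (tk p) (by omega) (by omega)
  obtain ⟨γ, hγ, hc⟩ := realise (tL p + tk p) (by omega) (by omega)
  obtain ⟨α', hα', ha'⟩ := realise (p - tH p) (by omega) (by omega)
  -- `α = −α'` has `λ(φα − α) = p − H`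
  have ha : lam (act φ (1 : ZMod n) (-α')) - lam (-α') = ((p - tH p : ℕ) : ZMod p) := by
    rw [map_neg, map_neg, map_neg, ← ha']; abel
  have hα : -α' ≠ 0 := neg_ne_zero.2 hα'
  have hβγ : β ≠ γ := by
    intro e
    rw [e, hc] at hb
    have := congrArg ZMod.val hb
    rw [ZMod.val_natCast, ZMod.val_natCast, Nat.mod_eq_of_lt (by omega), Nat.mod_eq_of_lt (by omega)] at this
    omega
  refine (boxF1 (-α') β γ).not_boxUseful_of_cosetPattern φ lam (tmplF1 p) (boxF1_nondeg φ hα hβ hγ hβγ h1) hlam ?_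
    (by rw [ZMod.card]; exact tmplF1_big p hp9 hL)
  apply valid_boxF1_of_validF1
  rw [hb, hc, ha]
  have hv := tmplF1_valid p hp9
  push_cast at hv ⊢
  exact hv

end AffExt

end Summit.MatrixMultiplication.OmegaCensus
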